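import Mathlib.Analysis.Calculus.MeanValue
import Mathlib.Analysis.Calculus.Deriv.Pow
import Mathlib.Analysis.Calculus.Deriv.Mul
import Mathlib.Analysis.Calculus.Deriv.Comp
import Mathlib.Analysis.SpecificLimits.Basic
import Mathlib.Topology.Connected.Clopen
import HarnessLib

/-!
# Taylor flatness on an interval for a family closed under `d/ds` with factorial bounds (no analyticity hypothesis)

Topic `Analysis/Calculus`; namespace `Literature.Analysis.Calculus`; THEOREMS ONLY (no definition, no instance, no notation, no
named fact, no `sorry`).  Companion of ★ `AnalyticFlatnessDerivFamily` (the analytic form, A-p14 (g24)): the SAME conclusion — a family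
`{f u}_{u ∈ V}` of functions on an interval with `(f u)' = f (D u)` and `f u (s₀) = 0` vanishes — but with the analyticity hypothesis
REPLACED by uniform-radius factorial bounds `‖f (D^n u) (s)‖ ≤ M_u · n! / r^n` (Taylor's theorem with the Lagrange∕integral remainder in
the fencing form of Mathlib's `image_norm_le_of_norm_deriv_right_le_deriv_boundary`, then an open–closed argument on the interval).
This is the uniqueness engine of the in-house road to the letter A6 `HasUnitaryGlobalizationOfInfUnitary` at `U(2,1)` (cell
`hodgecm-mathlib`, F0∕P3, ROAD-GLOB v1.1 bricks P3∕Φ2): there `f u (s) = ⟪Φ(γ(s)) ι u, ι w⟫` are matrix coefficients of `K`-finite vectors,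
`D = ρ(Y)` and the bounds are Harish-Chandra's factorial estimates `‖ρ(Y)^n u‖ ≤ C_u n! K^n ‖Y‖^n` for vectors of an admissible
`(𝔤, K)`-module [HarishChandra1953, §9, Lemma 34; Nelson1959, §2], while `s ↦ γ(s)` is only differentiable.

## Main statements

* `norm_le_mul_pow_div_factorial_of_hasDerivAt_family` — the Taylor estimate: if `(f u)' = f (D u)` on `[[s₀, s]]`, `f u s₀ = 0` for all `u`,
  and `‖f (D^[n] u)‖ ≤ M` on `[[s₀, s]]`, then `‖f u s‖ ≤ M · |s − s₀|^n / n!` [KrantzParks2002, §1.2].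
* `eqOn_zero_of_hasDerivAt_family_of_factorial_bound` — flatness: on an open preconnected `J ∋ s₀`, hypotheses `(f u)' = f (D u)` on `J`,
  `∃ r > 0, ∀ u, ∃ M, ∀ n, ∀ s ∈ J, ‖f (D^[n] u) s‖ ≤ M · n! / r^n`, `f u s₀ = 0` ⇒ `f u = 0` on `J`; two-family and whole-line corollaries.

## Mathlib ∕ tree search
Mathlib: `image_norm_le_of_norm_deriv_right_le_deriv_boundary` (fencing), `exists_pow_lt_of_lt_one`, `Subtype.preconnectedSpace`,
`IsClopen.eq_univ`, `Metric.isOpen_iff`.  Tree: ★ `Literature.Analysis.Calculus.eqOn_zero_of_hasDerivAt_family` (analytic form; this file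
removes `AnalyticOnNhd`), ★ `AnalyticOfDerivBound` (converse direction: bounds ⇒ analytic, needs global smoothness — not used).
Dedup: `rg "factorial_bound|TaylorFlatness" Literature/` — no hits.

## References
* S. G. Krantz, H. R. Parks, *A Primer of Real Analytic Functions*, 2nd ed. (2002), §1.2 (Taylor remainder and factorial bounds) [KrantzParks2002].
* Harish-Chandra, *Representations of a semisimple Lie group on a Banach space. I*, Trans. AMS 75 (1953), §9 [HarishChandra1953].
* E. Nelson, *Analytic vectors*, Ann. of Math. 70 (1959), §2 [Nelson1959].
-/

set_option autoImplicit false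

noncomputable section

open scoped Topology Nat
open Set Filter

namespace Literature.Analysis.Calculus

variable {F : Type*} [NormedAddCommGroup F] [NormedSpace ℝ F] {V : Type*}

/-- One fencing step to the right: on `[a, b]`, if `φ` is continuous, right-differentiable with `‖φ'(x)‖ ≤ M (x − a)^n / n!`, and
`φ a = 0`, then `‖φ x‖ ≤ M (x − a)^{n+1} / (n+1)!`. [cite: KrantzParks2002, §1.2] -/
theorem norm_le_mul_pow_succ_div_factorial_of_deriv_right {φ φ' : ℝ → F} {a b : ℝ} {M : ℝ} {n : ℕ}
    (hφ : ContinuousOn φ (Icc a b)) (hφ' : ∀ x ∈ Ico a b, HasDerivWithinAt φ (φ' x) (Ici x) x) (h0 : φ a = 0)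
    (hbound : ∀ x ∈ Ico a b, ‖φ' x‖ ≤ M * (x - a) ^ n / n !) :
    ∀ ⦃x⦄, x ∈ Icc a b → ‖φ x‖ ≤ M * (x - a) ^ (n + 1) / (n + 1)! := by
  have hB : ∀ x, HasDerivAt (fun y : ℝ => M * (y - a) ^ (n + 1) / (n + 1)!) (M * (x - a) ^ n / n !) x := by
    intro x
    have h1 : HasDerivAt (fun y : ℝ => (y - a) ^ (n + 1)) (((n + 1 : ℕ) : ℝ) * (x - a) ^ n) x := by
      have h := (hasDerivAt_pow (n + 1) (x - a)).comp x ((hasDerivAt_id x).sub_const a)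
      simpa [Function.comp_def] using h
    have h2 := (h1.const_mul M).div_const ((n + 1)! : ℝ)
    have heq : M * (((n + 1 : ℕ) : ℝ) * (x - a) ^ n) / ((n + 1)! : ℝ) = M * (x - a) ^ n / n ! := by
      rw [Nat.factorial_succ, Nat.cast_mul]
      have hn : ((n + 1 : ℕ) : ℝ) ≠ 0 := by positivity
      have hf : ((n ! : ℕ) : ℝ) ≠ 0 := by positivity
      field_simp
    rw [heq] at h2
    exact h2
  have ha : ‖φ a‖ ≤ M * (a - a) ^ (n + 1) / (n + 1)! := by simp [h0]
  exact image_norm_le_of_norm_deriv_right_le_deriv_boundary hφ hφ' ha hB hbound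

/-- **Taylor estimate for a `d/ds`-closed family vanishing at `s₀`.**  Let `f : V → ℝ → F`, `D : V → V` with
`HasDerivAt (f u) (f (D u) ξ) ξ` for all `u` and all `ξ ∈ [[s₀, s]]`, and `f u s₀ = 0` for all `u`.  If `‖f (D^[n] u) ξ‖ ≤ M` on `[[s₀, s]]`
then `‖f u s'‖ ≤ M · |s' − s₀|^n / n!` for every `s' ∈ [[s₀, s]]` (all Taylor coefficients `f (D^k u) s₀` vanish). [cite: KrantzParks2002, §1.2] -/
theorem norm_le_mul_pow_div_factorial_of_hasDerivAt_family (f : V → ℝ → F) (D : V → V) {s₀ s : ℝ}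
    (hder : ∀ u, ∀ ξ ∈ uIcc s₀ s, HasDerivAt (f u) (f (D u) ξ) ξ) (h0 : ∀ u, f u s₀ = 0) :
    ∀ (n : ℕ) (u : V) (M : ℝ), (∀ ξ ∈ uIcc s₀ s, ‖f (D^[n] u) ξ‖ ≤ M) →
      ∀ s' ∈ uIcc s₀ s, ‖f u s'‖ ≤ M * |s' - s₀| ^ n / n ! := by
  intro n
  induction n with
  | zero =>
    intro u M hM s' hs'
    simpa using hM s' hs'
  | succ n ih =>
    intro u M hM s' hs'
    -- the induction hypothesis for `D u`
    have hDu : ∀ ξ ∈ uIcc s₀ s, ‖f (D u) ξ‖ ≤ M * |ξ - s₀| ^ n / n ! :=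
      ih (D u) M (fun ξ hξ => by simpa [Function.iterate_succ_apply] using hM ξ hξ)
    have hsub : uIcc s₀ s' ⊆ uIcc s₀ s := uIcc_subset_uIcc_left hs'
    -- continuity of `f u` on `[[s₀, s']]`
    have hcont : ContinuousOn (f u) (uIcc s₀ s') :=
      fun ξ hξ => (hder u ξ (hsub hξ)).continuousAt.continuousWithinAt
    rcases le_total s₀ s' with hle | hle
    · -- to the right of `s₀`
      have hI : uIcc s₀ s' = Icc s₀ s' := uIcc_of_le hle
      have key := norm_le_mul_pow_succ_div_factorial_of_deriv_right (φ := f u) (φ' := f (D u)) (a := s₀) (b := s')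
        (M := M) (n := n) (by rwa [hI] at hcont)
        (fun x hx => (hder u x (hsub (by rw [hI]; exact Ico_subset_Icc_self hx))).hasDerivWithinAt) (h0 u)
        (fun x hx => by
          have h := hDu x (hsub (by rw [hI]; exact Ico_subset_Icc_self hx))
          rwa [abs_of_nonneg (sub_nonneg.mpr hx.1)] at h)
        (right_mem_Icc.mpr hle)
      rwa [abs_of_nonneg (sub_nonneg.mpr hle)]
    · -- to the left of `s₀`: reflect `x ↦ −x`
      have hI : uIcc s₀ s' = Icc s' s₀ := uIcc_of_ge hle
      set φ : ℝ → F := fun x => f u (-x) with hφ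
      set φ' : ℝ → F := fun x => -f (D u) (-x) with hφ'
      have hcontφ : ContinuousOn φ (Icc (-s₀) (-s')) := by
        refine (hcont.comp continuous_neg.continuousOn ?_)
        intro x hx
        rw [hI]
        exact ⟨by linarith [hx.2], by linarith [hx.1]⟩
      have hderφ : ∀ x ∈ Ico (-s₀) (-s'), HasDerivWithinAt φ (φ' x) (Ici x) x := by
        intro x hx
        have hx' : -x ∈ uIcc s₀ s := hsub (by rw [hI]; exact ⟨by linarith [hx.2], by linarith [hx.1]⟩)
        have h := (hder u (-x) hx').scomp x (hasDerivAt_neg x)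
        have h' : HasDerivAt φ (φ' x) x := by
          simpa [hφ, hφ', Function.comp_def] using h
        exact h'.hasDerivWithinAt
      have key := norm_le_mul_pow_succ_div_factorial_of_deriv_right (φ := φ) (φ' := φ') (a := -s₀) (b := -s')
        (M := M) (n := n) hcontφ hderφ (by simp [hφ, h0 u])
        (fun x hx => by
          have hx' : -x ∈ uIcc s₀ s := hsub (by rw [hI]; exact ⟨by linarith [hx.2], by linarith [hx.1]⟩)
          have h := hDu (-x) hx'
          rw [hφ', norm_neg]
          have habs : |-x - s₀| = x - -s₀ := by
            rw [abs_of_nonpos (by linarith [hx.1])]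
            ring
          rwa [habs] at h)
        (right_mem_Icc.mpr (by linarith))
      have habs : |s' - s₀| = -s' - -s₀ := by
        rw [abs_of_nonpos (sub_nonpos.mpr hle)]
        ring
      simpa [hφ, habs] using key

/-- **Local flatness**: with `(f u)' = f (D u)` on `[[s₀, s]]`, `f u s₀ = 0`, and the factorial bounds `‖f (D^[n] u) ξ‖ ≤ M · n! / r^n` on
`[[s₀, s]]` for all `n`, every `s` with `|s − s₀| < r` has `f u s = 0` (the Taylor remainders `M (|s − s₀|/r)^n` tend to `0`).
[cite: KrantzParks2002, §1.2] -/
theorem eq_zero_of_hasDerivAt_family_of_factorial_bound_near (f : V → ℝ → F) (D : V → V) {s₀ s : ℝ}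
    (hder : ∀ u, ∀ ξ ∈ uIcc s₀ s, HasDerivAt (f u) (f (D u) ξ) ξ) (h0 : ∀ u, f u s₀ = 0) (u : V) {r M : ℝ} (hr : 0 < r)
    (hbd : ∀ n, ∀ ξ ∈ uIcc s₀ s, ‖f (D^[n] u) ξ‖ ≤ M * n ! / r ^ n) (hs : |s - s₀| < r) : f u s = 0 := by
  have hq0 : 0 ≤ |s - s₀| / r := div_nonneg (abs_nonneg _) hr.le
  have hq1 : |s - s₀| / r < 1 := (div_lt_one hr).mpr hs
  -- `‖f u s‖ ≤ M q^n` for all `n`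
  have hest : ∀ n : ℕ, ‖f u s‖ ≤ M * (|s - s₀| / r) ^ n := by
    intro n
    have h := norm_le_mul_pow_div_factorial_of_hasDerivAt_family f D hder h0 n u (M * n ! / r ^ n) (hbd n) s right_mem_uIcc
    have hn : ((n ! : ℕ) : ℝ) ≠ 0 := by positivity
    have hrn : r ^ n ≠ 0 := pow_ne_zero n hr.ne'
    calc ‖f u s‖ ≤ M * n ! / r ^ n * |s - s₀| ^ n / n ! := h
      _ = M * (|s - s₀| / r) ^ n := by rw [div_pow]; field_simp
  have hM : 0 ≤ M := by
    have h := hest 0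
    simp only [pow_zero, mul_one] at h
    exact (norm_nonneg _).trans h
  by_contra hne
  have hpos : 0 < ‖f u s‖ := norm_pos_iff.mpr hne
  rcases hM.eq_or_lt with hM0 | hMpos
  · have h := hest 0
    rw [← hM0, zero_mul] at h
    exact absurd h (not_le.mpr hpos)
  · obtain ⟨n, hn⟩ := exists_pow_lt_of_lt_one (div_pos hpos hMpos) hq1
    have h := hest n
    rw [lt_div_iff₀ hMpos, mul_comm] at hn
    exact absurd h (not_le.mpr hn)

/-- **Taylor flatness on an interval for a `d/ds`-closed family with uniform-radius factorial bounds.**  Let `J ⊆ ℝ` be open and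
preconnected, `s₀ ∈ J`, `f : V → ℝ → F`, `D : V → V` with `HasDerivAt (f u) (f (D u) s) s` for all `u` and `s ∈ J`; suppose there is
ONE radius `r > 0` such that every `u` has a constant `M` with `‖f (D^[n] u) s‖ ≤ M · n! / r^n` for all `n` and all `s ∈ J`; and `f u s₀ = 0`
for all `u`.  THEN `f u = 0` on `J` for every `u`.  (No analyticity of `f u` is assumed; compare ★ `eqOn_zero_of_hasDerivAt_family`.)
[cite: KrantzParks2002, §1.2] [cite: Nelson1959, §2] -/
theorem eqOn_zero_of_hasDerivAt_family_of_factorial_bound {J : Set ℝ} (hJ : IsOpen J) (hJc : IsPreconnected J) {s₀ : ℝ}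
    (hs₀ : s₀ ∈ J) (f : V → ℝ → F) (D : V → V) (hder : ∀ u, ∀ s ∈ J, HasDerivAt (f u) (f (D u) s) s)
    {r : ℝ} (hr : 0 < r) (hbd : ∀ u, ∃ M, ∀ n, ∀ s ∈ J, ‖f (D^[n] u) s‖ ≤ M * n ! / r ^ n) (h0 : ∀ u, f u s₀ = 0) (u : V) :
    EqOn (f u) 0 J := by
  -- the set of points of `J` where the whole family vanishes is clopen in `J`
  haveI : PreconnectedSpace J := Subtype.preconnectedSpace hJc
  let Z : Set J := {x | ∀ u, f u (x : ℝ) = 0}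
  have hZcl : IsClosed Z := by
    have hZeq : Z = ⋂ u, (fun x : J => f u (x : ℝ)) ⁻¹' {0} := by
      ext x
      simp [Z]
    rw [hZeq]
    refine isClosed_iInter fun u => IsClosed.preimage ?_ isClosed_singleton
    have hc : ContinuousOn (f u) J := fun s hs => (hder u s hs).continuousAt.continuousWithinAt
    exact hc.restrict
  have hZop : IsOpen Z := by
    refine Metric.isOpen_iff.mpr fun x hx => ?_
    obtain ⟨δ, hδ, hball⟩ := Metric.isOpen_iff.mp hJ (x : ℝ) x.2
    refine ⟨min δ r, lt_min hδ hr, fun y hy u => ?_⟩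
    have hy' : dist (y : ℝ) (x : ℝ) < min δ r := hy
    have hyδ : |(y : ℝ) - x| < δ := lt_of_lt_of_le hy' (min_le_left _ _)
    have hyr : |(y : ℝ) - x| < r := lt_of_lt_of_le hy' (min_le_right _ _)
    -- the segment `[[x, y]]` lies in the ball, hence in `J`
    have hseg : uIcc (x : ℝ) y ⊆ J := by
      intro ξ hξ
      apply hball
      rw [Metric.mem_ball, Real.dist_eq]
      rcases le_total (x : ℝ) y with hle | hle
      · rw [uIcc_of_le hle] at hξ
        rw [abs_of_nonneg (sub_nonneg.mpr hle)] at hyδ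
        rw [abs_lt]
        constructor <;> linarith [hξ.1, hξ.2]
      · rw [uIcc_of_ge hle] at hξ
        rw [abs_of_nonpos (sub_nonpos.mpr hle)] at hyδ
        rw [abs_lt]
        constructor <;> linarith [hξ.1, hξ.2]
    obtain ⟨M, hM⟩ := hbd u
    exact eq_zero_of_hasDerivAt_family_of_factorial_bound_near f D (s₀ := x) (s := y)
      (fun u' ξ hξ => hder u' ξ (hseg hξ)) (fun u' => hx u') u hr (fun n ξ hξ => hM n ξ (hseg hξ)) hyr
  have hZ : Z = univ := IsClopen.eq_univ ⟨hZcl, hZop⟩ ⟨⟨s₀, hs₀⟩, h0⟩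
  intro s hs
  have hmem : (⟨s, hs⟩ : J) ∈ Z := by rw [hZ]; exact mem_univ _
  exact hmem u

/-- **Two-family form**: two `d/ds`-closed families on `J` (same `D`) with uniform-radius factorial bounds that agree at `s₀` agree on `J`.
[cite: KrantzParks2002, §1.2] [cite: Nelson1959, §2] -/
theorem eqOn_of_hasDerivAt_family_of_factorial_bound {J : Set ℝ} (hJ : IsOpen J) (hJc : IsPreconnected J) {s₀ : ℝ}
    (hs₀ : s₀ ∈ J) (f g : V → ℝ → F) (D : V → V) (hfder : ∀ u, ∀ s ∈ J, HasDerivAt (f u) (f (D u) s) s)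
    (hgder : ∀ u, ∀ s ∈ J, HasDerivAt (g u) (g (D u) s) s) {r : ℝ} (hr : 0 < r)
    (hfbd : ∀ u, ∃ M, ∀ n, ∀ s ∈ J, ‖f (D^[n] u) s‖ ≤ M * n ! / r ^ n)
    (hgbd : ∀ u, ∃ M, ∀ n, ∀ s ∈ J, ‖g (D^[n] u) s‖ ≤ M * n ! / r ^ n) (h0 : ∀ u, f u s₀ = g u s₀) (u : V) :
    EqOn (f u) (g u) J := by
  have hbd : ∀ u, ∃ M, ∀ n, ∀ s ∈ J, ‖(fun u s => f u s - g u s) (D^[n] u) s‖ ≤ M * n ! / r ^ n := by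
    intro u
    obtain ⟨M₁, h₁⟩ := hfbd u
    obtain ⟨M₂, h₂⟩ := hgbd u
    refine ⟨M₁ + M₂, fun n s hs => ?_⟩
    calc ‖f (D^[n] u) s - g (D^[n] u) s‖ ≤ ‖f (D^[n] u) s‖ + ‖g (D^[n] u) s‖ := norm_sub_le _ _
      _ ≤ M₁ * n ! / r ^ n + M₂ * n ! / r ^ n := add_le_add (h₁ n s hs) (h₂ n s hs)
      _ = (M₁ + M₂) * n ! / r ^ n := by ring
  have h := eqOn_zero_of_hasDerivAt_family_of_factorial_bound hJ hJc hs₀ (fun u s => f u s - g u s) D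
    (fun u s hs => (hfder u s hs).sub (hgder u s hs)) hr hbd (fun u => sub_eq_zero.mpr (h0 u)) u
  intro s hs
  exact sub_eq_zero.mp (h hs)

/-- The whole-line form (`J = univ`): a `d/ds`-closed family with uniform-radius factorial bounds on `ℝ` vanishing at one point vanishes
identically. [cite: KrantzParks2002, §1.2] [cite: Nelson1959, §2] -/
theorem eq_zero_of_hasDerivAt_family_of_factorial_bound_univ (s₀ : ℝ) (f : V → ℝ → F) (D : V → V)
    (hder : ∀ u s, HasDerivAt (f u) (f (D u) s) s) {r : ℝ} (hr : 0 < r)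
    (hbd : ∀ u, ∃ M, ∀ n s, ‖f (D^[n] u) s‖ ≤ M * n ! / r ^ n) (h0 : ∀ u, f u s₀ = 0) (u : V) (s : ℝ) :
    f u s = 0 :=
  eqOn_zero_of_hasDerivAt_family_of_factorial_bound isOpen_univ isPreconnected_univ (mem_univ s₀) f D
    (fun u s _ => hder u s) hr (fun u => (hbd u).elim fun M hM => ⟨M, fun n s _ => hM n s⟩) h0 u (mem_univ s)

/-- The whole-line two-family form. [cite: KrantzParks2002, §1.2] [cite: Nelson1959, §2] -/
theorem eq_of_hasDerivAt_family_of_factorial_bound_univ (s₀ : ℝ) (f g : V → ℝ → F) (D : V → V)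
    (hfder : ∀ u s, HasDerivAt (f u) (f (D u) s) s) (hgder : ∀ u s, HasDerivAt (g u) (g (D u) s) s) {r : ℝ} (hr : 0 < r)
    (hfbd : ∀ u, ∃ M, ∀ n s, ‖f (D^[n] u) s‖ ≤ M * n ! / r ^ n) (hgbd : ∀ u, ∃ M, ∀ n s, ‖g (D^[n] u) s‖ ≤ M * n ! / r ^ n)
    (h0 : ∀ u, f u s₀ = g u s₀) (u : V) (s : ℝ) : f u s = g u s :=
  eqOn_of_hasDerivAt_family_of_factorial_bound isOpen_univ isPreconnected_univ (mem_univ s₀) f g D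
    (fun u s _ => hfder u s) (fun u s _ => hgder u s) hr (fun u => (hfbd u).elim fun M hM => ⟨M, fun n s _ => hM n s⟩)
    (fun u => (hgbd u).elim fun M hM => ⟨M, fun n s _ => hM n s⟩) h0 u (mem_univ s)

end Literature.Analysis.Calculus

end
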